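import Summits.CriticalPhenomena.PercolationContinuityZ3.Theorems.Transplant.FKConnectivityAllQPat3GraphCone
import Summits.CriticalPhenomena.PercolationContinuityZ3.Theorems.Transplant.FKConnectivityAllQPat3TwoLevelInduction
import Summits.CriticalPhenomena.PercolationContinuityZ3.Theorems.Transplant.FKConnectivityAllQPat3URect
import HarnessLib

/-!
# Connectivity correlation inequalities for `φ_{w,q}`, every `q > 0` — the GENERATOR DICTIONARY of product-cone certificates
# (Stage S2, part 2d): validity of certificate products from THEOREMS 𝒯₁/𝒯₂/U, and THEOREM SP on THETA / RING graphs from data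

Definitions + theorems file (`--supports stmt-CriticalPhenomena-4575`), census lane `prim-bschramm-census` (gen 36) of the post-continuity programme (LANE 2 bschramm, FK sub-lane);
builds on p205010 (kernel theorem, internal audit signed; external expert review pending).
No named facts, no sorries; standard axioms.  The last generic layer before the data files: a certificate's products name their
generators through `FK.Gen` — `fam t` (a two-level table claimed to be one of the 14 members of `FK.famT12`, THEOREMS 𝒯₁/𝒯₂ with
mirrors; the claim is CHECKED by `FK.Gen.ok` = agreement with some member on levels 0, 1), `urect U D` / `usym U D` (THEOREM U's rectangle
`FK.uRect_nonneg` or its flip-symmetrisation; up-set / down-set checked), `entry c P Q` / `orb P Q` (an entry resp. flip-orbit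
indicator, nonnegative coefficientwise) — so that the validity
hypothesis `hval` of `FK.theta_level_nonneg_of_cert` / `FK.ring_level_nonneg_of_cert` is discharged once and for all
(`FK.Gen.lev2_nonneg`) from `FK.IsTTSP` of the three pieces with inner marks:
* `FK.lift1`, `FK.Gen`, `FK.orbTab`, `FK.usymTab`, `FK.Gen.tab`, `FK.agrees01` (+`_spec`), `FK.Gen.ok`, `FK.lev2_congr01`,
  `FK.mval2_nonneg_of_coef`, `FK.mval2_lift1`, `FK.tval_transpose`, `FK.tval_usymTab`, **`FK.Gen.lev2_nonneg`**;
* `FK.Prod3G` (+`toProd3`, `ok`, `valid3`), **`FK.theta_level_nonneg_of_certG`** / **`…_of_symCertG`**,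
  **`FK.ring_level_nonneg_of_certG`** / **`…_of_symCertG`** — hypotheses: the
  geometry of the gluing, `IsTTSP` of each piece between its corners, marks on their pieces and off the corners, `prods.all Prod3G.ok`
  (one `decide`), and the certificate family for `prods.map Prod3G.toProd3` (`FK.cert_of_pairs` /
  `FK.symCert_of_pairs` of `…Pat3FastCheck.lean`, 25 `decide +kernel` declarations); conclusion `0 ≤ D · lev2 (E_K ∪ E₁ ∪ E₂) b s t T λ` for every level `λ`.
A DATA FILE is then: `def prods : List Prod3G := [⟨lam, shift, Gen.fam tsym2Tab, Gen.entry 0 Pat3.all Pat3.sep, Gen.urect U D⟩, …]`,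
`theorem ok : prods.all Prod3G.ok = true := by decide`, the 25 pair theorems, and the instantiated THEOREM.
[cite: AyyerLinussonRavichandran2025, §7 eq. (13)–(15) (p. 22)] [cite: Grimmett2006, §3.8 (pp. 61–62)]
-/

noncomputable section

namespace Summit.CriticalPhenomena.PercolationContinuityZ3.Theorems

namespace FK

open SimpleGraph Literature.Probability.LatticeModels Literature.Probability.Percolation



/-! ### Generator dictionary: validity of certificate products from THEOREMS 𝒯₁/𝒯₂/U (census g36) -/

section GenDict

/-- A one-level table embedded as a two-level table (at level `0`). [folklore] -/
def lift1 (t : Pat3 → Pat3 → ℤ) : ℕ → Pat3 → Pat3 → ℤ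
  | 0, P, Q => t P Q
  | _ + 1, _, _ => 0

/-- The generators a product-cone certificate may use on a piece: a two-level table CLAIMED to be a member of the closed family
`FK.famT12` (THEOREMS 𝒯₁/𝒯₂; the claim is checked by `FK.Gen.ok`), a U-rectangle (THEOREM U, one level; up-set / down-set checked by
`FK.Gen.ok`) or its flip-symmetrisation, an entry indicator or a flip-orbit indicator (trivially nonnegative). [folklore] -/
inductive Gen : Type
  | fam (t : ℕ → Pat3 → Pat3 → ℤ)
  | urect (U D : Pat3 → Bool)
  | usym (U D : Pat3 → Bool)
  | entry (c : ℕ) (P Q : Pat3)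
  | orb (P Q : Pat3)

/-- The flip-orbit indicator of a pattern pair at level `0` (census's symmetrised entry coordinates `e_i`). [folklore] -/
def orbTab (P₀ Q₀ : Pat3) : ℕ → Pat3 → Pat3 → ℤ :=
  fun c P Q => if c = 0 ∧ (P = P₀ ∧ Q = Q₀ ∨ P = Q₀ ∧ Q = P₀) then 1 else 0

/-- The flip-symmetrised U-rectangle `uRectTab U D + (uRectTab U D)ᵀ` (one level). [folklore] -/
def usymTab (U D : Pat3 → Bool) : Pat3 → Pat3 → ℤ :=
  fun P Q => uRectTab U D P Q + uRectTab U D Q P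

/-- The two-level table of a generator. [folklore] -/
def Gen.tab : Gen → ℕ → Pat3 → Pat3 → ℤ
  | Gen.fam t => t
  | Gen.urect U D => lift1 (uRectTab U D)
  | Gen.usym U D => lift1 (usymTab U D)
  | Gen.entry c₀ P₀ Q₀ => fun c P Q => if c = c₀ ∧ P = P₀ ∧ Q = Q₀ then 1 else 0
  | Gen.orb P₀ Q₀ => orbTab P₀ Q₀

/-- Two two-level tables agree on levels `0` and `1` (all that `FK.mval2` / `FK.lev2` read). [folklore] -/
def agrees01 (F G : ℕ → Pat3 → Pat3 → ℤ) : Bool :=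
  Pat3.list.all fun P => Pat3.list.all fun Q => decide (F 0 P Q = G 0 P Q) && decide (F 1 P Q = G 1 P Q)

/-- What `FK.agrees01` says. [folklore] -/
theorem agrees01_spec {F G : ℕ → Pat3 → Pat3 → ℤ} (h : agrees01 F G = true) :
    (∀ P Q, F 0 P Q = G 0 P Q) ∧ (∀ P Q, F 1 P Q = G 1 P Q) := by
  unfold agrees01 at h
  simp only [List.all_eq_true, Bool.and_eq_true, decide_eq_true_eq] at h
  exact ⟨fun P Q => (h P P.mem_list Q Q.mem_list).1, fun P Q => (h P P.mem_list Q Q.mem_list).2⟩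

/-- Executable side condition of a generator: a claimed family member agrees with one of the 14 members of `FK.famT12` on levels
`0, 1`; a U-rectangle has an up-set and a down-set; entries are unconditional. [folklore] -/
def Gen.ok : Gen → Bool
  | Gen.fam t => (List.range 14).any fun i => agrees01 t (famGet famT12 i)
  | Gen.urect U D => Pat3.isUpper U && Pat3.isLower D
  | Gen.usym U D => Pat3.isUpper U && Pat3.isLower D
  | Gen.entry _ _ _ => true
  | Gen.orb _ _ => true

open scoped Classical

variable {V : Type*}

/-- `FK.lev2` reads only levels `0` and `1` of the table. [folklore] -/
theorem lev2_congr01 {F G : ℕ → Pat3 → Pat3 → ℤ} (h0 : ∀ P Q, F 0 P Q = G 0 P Q) (h1 : ∀ P Q, F 1 P Q = G 1 P Q)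
    (E : Finset (Sym2 V)) (x y s : V) (μ : ℕ) : lev2 E x y s F μ = lev2 E x y s G μ := by
  unfold lev2
  simp only [h0, h1]

/-- A two-level table with nonnegative coefficients evaluates nonnegatively against nonnegative weights. [folklore] -/
theorem mval2_nonneg_of_coef {E : Finset (Sym2 V)} {x y s : V} {F : ℕ → Pat3 → Pat3 → ℤ} (hF : ∀ c P Q, 0 ≤ F c P Q)
    {w : ℕ → ℝ} (hw : ∀ n, 0 ≤ w n) : 0 ≤ mval2 w E x y s F := by
  unfold mval2
  refine Finset.sum_nonneg fun γ _ => add_nonneg (mul_nonneg (hw _) ?_) (mul_nonneg (hw _) ?_) <;> exact_mod_cast hF _ _ _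

/-- The weighted value of an embedded one-level table is its one-level value. [folklore] -/
theorem mval2_lift1 (w : ℕ → ℝ) (E : Finset (Sym2 V)) (x y s : V) (t : Pat3 → Pat3 → ℤ) :
    mval2 w E x y s (lift1 t) = tval w E x y s t := by
  rw [mval2_eq_tval_add]
  have h0 : tval (fun n => w (n + 1)) E x y s (lift1 t 1) = 0 := by
    unfold tval
    exact Finset.sum_eq_zero fun γ _ => by simp [lift1]
  rw [h0, add_zero]
  rfl

/-- The one-level value is invariant under transposing the table (flip `γ ↦ E ∖ γ`). [folklore] -/
theorem tval_transpose (w : ℕ → ℝ) (E : Finset (Sym2 V)) (x y s : V) (t : Pat3 → Pat3 → ℤ) :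
    tval w E x y s (fun P Q => t Q P) = tval w E x y s t := by
  unfold tval
  rw [sum_powerset_flip E (fun γ => w (apExp E γ) * (t (pat3 γ x y s) (pat3 (E \ γ) x y s) : ℝ))]
  refine Finset.sum_congr rfl fun γ hγ => ?_
  have h := Finset.mem_powerset.1 hγ
  rw [apExp_compl h, Finset.sdiff_sdiff_eq_self h]

/-- The value of the symmetrised U-rectangle is twice the value of the rectangle. [folklore] -/
theorem tval_usymTab (w : ℕ → ℝ) (E : Finset (Sym2 V)) (x y s : V) (U D : Pat3 → Bool) :
    tval w E x y s (usymTab U D) = 2 * tval w E x y s (uRectTab U D) := by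
  have e : tval w E x y s (usymTab U D) =
      tval w E x y s (uRectTab U D) + tval w E x y s (fun P Q => uRectTab U D Q P) := by
    unfold tval
    rw [← Finset.sum_add_distrib]
    refine Finset.sum_congr rfl fun γ _ => ?_
    simp only [usymTab]
    push_cast
    ring
  rw [e, tval_transpose, two_mul]

variable [Fintype V]

/-- **Validity of the dictionary**: on a two-terminal series–parallel piece `E` between `x, y` with inner mark `s`, every generator
passing `FK.Gen.ok` is levelwise nonnegative (`FK.famT12_nonneg`, `FK.uRect_nonneg`, coefficientwise for entries). [folklore] -/
theorem Gen.lev2_nonneg {E : Finset (Sym2 V)} {x y s : V} (hE : IsTTSP E x y) (hs : ∃ e ∈ E, s ∈ e) (hsx : s ≠ x)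
    (hsy : s ≠ y) : ∀ g : Gen, g.ok = true → ∀ μ : ℕ, 0 ≤ lev2 E x y s g.tab μ
  | Gen.fam t, h, μ => by
      unfold Gen.ok at h
      rw [List.any_eq_true] at h
      obtain ⟨i, _, hi⟩ := h
      have ha := agrees01_spec hi
      rw [Gen.tab, lev2_congr01 ha.1 ha.2]
      exact lev2_nonneg_of_mval2 (fun w hw => famT12_nonneg hE hs hsx hsy hw i) μ
  | Gen.urect U D, h, μ => by
      unfold Gen.ok at h
      rw [Bool.and_eq_true] at h
      refine lev2_nonneg_of_mval2 (fun w hw => ?_) μ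
      rw [Gen.tab, mval2_lift1]
      exact uRect_nonneg hE s h.1 h.2 hw
  | Gen.usym U D, h, μ => by
      unfold Gen.ok at h
      rw [Bool.and_eq_true] at h
      refine lev2_nonneg_of_mval2 (fun w hw => ?_) μ
      rw [Gen.tab, mval2_lift1, tval_usymTab]
      exact mul_nonneg (by norm_num) (uRect_nonneg hE s h.1 h.2 hw)
  | Gen.entry c₀ P₀ Q₀, _, μ =>
      lev2_nonneg_of_mval2 (fun w hw => mval2_nonneg_of_coef (fun c P Q => by
        simp only [Gen.tab]; split_ifs <;> norm_num) hw) μ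
  | Gen.orb P₀ Q₀, _, μ =>
      lev2_nonneg_of_mval2 (fun w hw => mval2_nonneg_of_coef (fun c P Q => by
        simp only [Gen.tab, orbTab]; split_ifs <;> norm_num) hw) μ

/-- A certificate product over the dictionary. [folklore] -/
structure Prod3G where
  /-- numerator of the multiplier -/
  lam : ℕ
  /-- level shift -/
  shift : ℕ
  /-- generator on the first piece -/
  gK : Gen
  /-- generator on the second piece -/
  g1 : Gen
  /-- generator on the third piece -/
  g2 : Gen

/-- The raw product (tables) of a dictionary product. [folklore] -/
def Prod3G.toProd3 (p : Prod3G) : Prod3 := ⟨p.lam, p.shift, p.gK.tab, p.g1.tab, p.g2.tab⟩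

/-- All three generators pass their side conditions. [folklore] -/
def Prod3G.ok (p : Prod3G) : Bool := p.gK.ok && p.g1.ok && p.g2.ok

/-- **Validity of a dictionary product list on three series–parallel pieces** (each between its corners `x_p, y_p` with
inner mark `s_p`): every product's three generators are levelwise nonnegative on their pieces. [folklore] -/
theorem Prod3G.valid3 {EK E₁ E₂ : Finset (Sym2 V)} {xK yK sK x₁ y₁ s₁ x₂ y₂ s₂ : V}
    (hKsp : IsTTSP EK xK yK) (h1sp : IsTTSP E₁ x₁ y₁) (h2sp : IsTTSP E₂ x₂ y₂)
    (hbK : ∃ e ∈ EK, sK ∈ e) (hs1 : ∃ e ∈ E₁, s₁ ∈ e) (ht2 : ∃ e ∈ E₂, s₂ ∈ e)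
    (hKx : sK ≠ xK) (hKy : sK ≠ yK) (h1x : s₁ ≠ x₁) (h1y : s₁ ≠ y₁) (h2x : s₂ ≠ x₂) (h2y : s₂ ≠ y₂)
    (prods : List Prod3G) (hok : (prods.all Prod3G.ok) = true) :
    ∀ j ∈ (Finset.univ : Finset (Fin (prods.map Prod3G.toProd3).length)), ∀ μ : ℕ,
      0 ≤ lev2 EK xK yK sK ((prods.map Prod3G.toProd3).get j).gK μ ∧
        0 ≤ lev2 E₁ x₁ y₁ s₁ ((prods.map Prod3G.toProd3).get j).g1 μ ∧
        0 ≤ lev2 E₂ x₂ y₂ s₂ ((prods.map Prod3G.toProd3).get j).g2 μ := by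
  intro j _ μ
  have hp : (prods.map Prod3G.toProd3).get j ∈ prods.map Prod3G.toProd3 := List.get_mem _ j
  rw [List.mem_map] at hp
  obtain ⟨g, hg, hgj⟩ := hp
  rw [← hgj]
  rw [List.all_eq_true] at hok
  have h := hok g hg
  simp only [Prod3G.ok, Bool.and_eq_true] at h
  exact ⟨Gen.lev2_nonneg hKsp hbK hKx hKy _ h.1.1 μ, Gen.lev2_nonneg h1sp hs1 h1x h1y _ h.1.2 μ,
    Gen.lev2_nonneg h2sp ht2 h2x h2y _ h.2 μ⟩

/-- **THEOREM SP on THETA graphs from data (entrywise certificate)**: three two-terminal series–parallel pieces glued in parallel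
between `u, v` with inner marks `b, s, t`, a target `T`, a product list over the dictionary passing `Prod3G.ok` (one `decide`), and
the entrywise certificate family for `prods.map Prod3G.toProd3` (`FK.cert_of_pairs`) ⇒ `0 ≤ D · lev2 (E_K ∪ E₁ ∪ E₂) b s t T λ` at
every level. [cite: AyyerLinussonRavichandran2025, §7 (p. 22)] -/
theorem theta_level_nonneg_of_certG {EK E₁ E₂ : Finset (Sym2 V)} {VK V₁ V₂ : Set V} {u v b s t : V}
    (hdK1 : Disjoint EK E₁) (hdK2 : Disjoint EK E₂) (hd12 : Disjoint E₁ E₂)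
    (hK : ∀ e ∈ (↑EK : Set (Sym2 V)), ∀ z ∈ e, z ∈ VK)
    (h₁ : ∀ e ∈ (↑E₁ : Set (Sym2 V)), ∀ z ∈ e, z ∈ V₁) (h₂ : ∀ e ∈ (↑E₂ : Set (Sym2 V)), ∀ z ∈ e, z ∈ V₂)
    (hK1 : VK ∩ V₁ ⊆ ({u, v} : Set V)) (hK2 : VK ∩ V₂ ⊆ ({u, v} : Set V)) (h12 : V₁ ∩ V₂ ⊆ ({u, v} : Set V)) (huv : u ≠ v)
    (hb1 : b ∉ V₁) (hb2 : b ∉ V₂) (hsK : s ∉ VK) (hs2 : s ∉ V₂) (htK : t ∉ VK) (ht1 : t ∉ V₁)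
    (hbu : b ≠ u) (hbv : b ≠ v) (hsu : s ≠ u) (hsv : s ≠ v) (htu : t ≠ u) (htv : t ≠ v)
    (hbs : b ≠ s) (hbt : b ≠ t) (hst : s ≠ t)
    (hKsp : IsTTSP EK u v) (h1sp : IsTTSP E₁ u v) (h2sp : IsTTSP E₂ u v)
    (hbK : ∃ e ∈ EK, b ∈ e) (hs1 : ∃ e ∈ E₁, s ∈ e) (ht2 : ∃ e ∈ E₂, t ∈ e)
    (T : ℕ → Pat3 → Pat3 → ℤ) (D : ℕ) (prods : List Prod3G) (hok : (prods.all Prod3G.ok) = true)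
    (hcert : ∀ d : ℕ, ∀ PK QK P1 Q1 P2 Q2 : Pat3,
      ∑ j : Fin (prods.map Prod3G.toProd3).length, (((prods.map Prod3G.toProd3).get j).lam : ℤ) * ((prods.map Prod3G.toProd3).get j).tensor d PK QK P1 Q1 P2 Q2 ≤
        D * target3 join3 corr3 T d PK QK P1 Q1 P2 Q2)
    (lam : ℕ) : 0 ≤ (D : ℤ) * lev2 (EK ∪ E₁ ∪ E₂) b s t T lam :=
  theta_level_nonneg_of_cert hdK1 hdK2 hd12 hK h₁ h₂ hK1 hK2 h12 huv hb1 hb2 hsK hs2 htK ht1 hbu hbv hsu hsv htu htv hbs hbt hst T D Finset.univ (fun j => (prods.map Prod3G.toProd3).get j) hcert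
    (Prod3G.valid3 hKsp h1sp h2sp hbK hs1 ht2 hbu hbv hsu hsv htu htv prods hok) lam

/-- **THEOREM SP on THETA graphs from data (symmetrised certificate, census g34's form; `FK.symCert_of_pairs`).**
[cite: AyyerLinussonRavichandran2025, §7 (p. 22)] -/
theorem theta_level_nonneg_of_symCertG {EK E₁ E₂ : Finset (Sym2 V)} {VK V₁ V₂ : Set V} {u v b s t : V}
    (hdK1 : Disjoint EK E₁) (hdK2 : Disjoint EK E₂) (hd12 : Disjoint E₁ E₂)
    (hK : ∀ e ∈ (↑EK : Set (Sym2 V)), ∀ z ∈ e, z ∈ VK)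
    (h₁ : ∀ e ∈ (↑E₁ : Set (Sym2 V)), ∀ z ∈ e, z ∈ V₁) (h₂ : ∀ e ∈ (↑E₂ : Set (Sym2 V)), ∀ z ∈ e, z ∈ V₂)
    (hK1 : VK ∩ V₁ ⊆ ({u, v} : Set V)) (hK2 : VK ∩ V₂ ⊆ ({u, v} : Set V)) (h12 : V₁ ∩ V₂ ⊆ ({u, v} : Set V)) (huv : u ≠ v)
    (hb1 : b ∉ V₁) (hb2 : b ∉ V₂) (hsK : s ∉ VK) (hs2 : s ∉ V₂) (htK : t ∉ VK) (ht1 : t ∉ V₁)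
    (hbu : b ≠ u) (hbv : b ≠ v) (hsu : s ≠ u) (hsv : s ≠ v) (htu : t ≠ u) (htv : t ≠ v)
    (hbs : b ≠ s) (hbt : b ≠ t) (hst : s ≠ t)
    (hKsp : IsTTSP EK u v) (h1sp : IsTTSP E₁ u v) (h2sp : IsTTSP E₂ u v)
    (hbK : ∃ e ∈ EK, b ∈ e) (hs1 : ∃ e ∈ E₁, s ∈ e) (ht2 : ∃ e ∈ E₂, t ∈ e)
    (T : ℕ → Pat3 → Pat3 → ℤ) (D : ℕ) (prods : List Prod3G) (hok : (prods.all Prod3G.ok) = true)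
    (hcert : ∀ d : ℕ, ∀ PK QK P1 Q1 P2 Q2 : Pat3,
      8 * ∑ j : Fin (prods.map Prod3G.toProd3).length, (((prods.map Prod3G.toProd3).get j).lam : ℤ) * ((prods.map Prod3G.toProd3).get j).tensor d PK QK P1 Q1 P2 Q2 ≤
        D * target3Sym join3 corr3 T d PK QK P1 Q1 P2 Q2)
    (lam : ℕ) : 0 ≤ (D : ℤ) * lev2 (EK ∪ E₁ ∪ E₂) b s t T lam :=
  theta_level_nonneg_of_symCert hdK1 hdK2 hd12 hK h₁ h₂ hK1 hK2 h12 huv hb1 hb2 hsK hs2 htK ht1 hbu hbv hsu hsv htu htv hbs hbt hst T D Finset.univ (fun j => (prods.map Prod3G.toProd3).get j) hcert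
    (Prod3G.valid3 hKsp h1sp h2sp hbK hs1 ht2 hbu hbv hsu hsv htu htv prods hok) lam

/-- **THEOREM SP on RING graphs from data (entrywise certificate)** (pieces `K(v,u;b)`, `Q₁(u,w;s)`, `Q₂(w,v;t)`, each
two-terminal series–parallel between its corners, marks inner). [cite: AyyerLinussonRavichandran2025, §7 (p. 22)] -/
theorem ring_level_nonneg_of_certG {EK E₁ E₂ : Finset (Sym2 V)} {VK V₁ V₂ : Set V} {u v w b s t : V}
    (hdK1 : Disjoint EK E₁) (hdK2 : Disjoint EK E₂) (hd12 : Disjoint E₁ E₂)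
    (hK : ∀ e ∈ (↑EK : Set (Sym2 V)), ∀ z ∈ e, z ∈ VK)
    (h₁ : ∀ e ∈ (↑E₁ : Set (Sym2 V)), ∀ z ∈ e, z ∈ V₁) (h₂ : ∀ e ∈ (↑E₂ : Set (Sym2 V)), ∀ z ∈ e, z ∈ V₂)
    (hK1 : VK ∩ V₁ ⊆ ({u} : Set V)) (h12 : V₁ ∩ V₂ ⊆ ({w} : Set V)) (hK2 : VK ∩ V₂ ⊆ ({v} : Set V))
    (hu2 : u ∉ V₂) (hv1 : v ∉ V₁) (huv : u ≠ v) (huw : u ≠ w) (hvw : v ≠ w)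
    (hb1 : b ∉ V₁) (hb2 : b ∉ V₂) (hsK : s ∉ VK) (hs2 : s ∉ V₂) (htK : t ∉ VK) (ht1 : t ∉ V₁)
    (hbu : b ≠ u) (hbv : b ≠ v) (hsu : s ≠ u) (hsv : s ≠ v) (hsw : s ≠ w) (htu : t ≠ u) (htv : t ≠ v) (htw : t ≠ w)
    (hbs : b ≠ s) (hbt : b ≠ t) (hst : s ≠ t)
    (hKsp : IsTTSP EK v u) (h1sp : IsTTSP E₁ u w) (h2sp : IsTTSP E₂ w v)
    (hbK : ∃ e ∈ EK, b ∈ e) (hs1 : ∃ e ∈ E₁, s ∈ e) (ht2 : ∃ e ∈ E₂, t ∈ e)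
    (T : ℕ → Pat3 → Pat3 → ℤ) (D : ℕ) (prods : List Prod3G) (hok : (prods.all Prod3G.ok) = true)
    (hcert : ∀ d : ℕ, ∀ PK QK P1 Q1 P2 Q2 : Pat3,
      ∑ j : Fin (prods.map Prod3G.toProd3).length, (((prods.map Prod3G.toProd3).get j).lam : ℤ) * ((prods.map Prod3G.toProd3).get j).tensor d PK QK P1 Q1 P2 Q2 ≤
        D * target3 joinRing corrRing T d PK QK P1 Q1 P2 Q2)
    (lam : ℕ) : 0 ≤ (D : ℤ) * lev2 (EK ∪ E₁ ∪ E₂) b s t T lam :=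
  ring_level_nonneg_of_cert hdK1 hdK2 hd12 hK h₁ h₂ hK1 h12 hK2 hu2 hv1 huv huw hvw hb1 hb2 hsK hs2 htK ht1 hbu hbv hsu hsv hsw htu htv htw hbs hbt hst T D Finset.univ (fun j => (prods.map Prod3G.toProd3).get j) hcert
    (Prod3G.valid3 hKsp h1sp h2sp hbK hs1 ht2 hbv hbu hsu hsw htw htv prods hok) lam

/-- **THEOREM SP on RING graphs from data (symmetrised certificate).** [cite: AyyerLinussonRavichandran2025, §7 (p. 22)] -/
theorem ring_level_nonneg_of_symCertG {EK E₁ E₂ : Finset (Sym2 V)} {VK V₁ V₂ : Set V} {u v w b s t : V}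
    (hdK1 : Disjoint EK E₁) (hdK2 : Disjoint EK E₂) (hd12 : Disjoint E₁ E₂)
    (hK : ∀ e ∈ (↑EK : Set (Sym2 V)), ∀ z ∈ e, z ∈ VK)
    (h₁ : ∀ e ∈ (↑E₁ : Set (Sym2 V)), ∀ z ∈ e, z ∈ V₁) (h₂ : ∀ e ∈ (↑E₂ : Set (Sym2 V)), ∀ z ∈ e, z ∈ V₂)
    (hK1 : VK ∩ V₁ ⊆ ({u} : Set V)) (h12 : V₁ ∩ V₂ ⊆ ({w} : Set V)) (hK2 : VK ∩ V₂ ⊆ ({v} : Set V))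
    (hu2 : u ∉ V₂) (hv1 : v ∉ V₁) (huv : u ≠ v) (huw : u ≠ w) (hvw : v ≠ w)
    (hb1 : b ∉ V₁) (hb2 : b ∉ V₂) (hsK : s ∉ VK) (hs2 : s ∉ V₂) (htK : t ∉ VK) (ht1 : t ∉ V₁)
    (hbu : b ≠ u) (hbv : b ≠ v) (hsu : s ≠ u) (hsv : s ≠ v) (hsw : s ≠ w) (htu : t ≠ u) (htv : t ≠ v) (htw : t ≠ w)
    (hbs : b ≠ s) (hbt : b ≠ t) (hst : s ≠ t)
    (hKsp : IsTTSP EK v u) (h1sp : IsTTSP E₁ u w) (h2sp : IsTTSP E₂ w v)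
    (hbK : ∃ e ∈ EK, b ∈ e) (hs1 : ∃ e ∈ E₁, s ∈ e) (ht2 : ∃ e ∈ E₂, t ∈ e)
    (T : ℕ → Pat3 → Pat3 → ℤ) (D : ℕ) (prods : List Prod3G) (hok : (prods.all Prod3G.ok) = true)
    (hcert : ∀ d : ℕ, ∀ PK QK P1 Q1 P2 Q2 : Pat3,
      8 * ∑ j : Fin (prods.map Prod3G.toProd3).length, (((prods.map Prod3G.toProd3).get j).lam : ℤ) * ((prods.map Prod3G.toProd3).get j).tensor d PK QK P1 Q1 P2 Q2 ≤
        D * target3Sym joinRing corrRing T d PK QK P1 Q1 P2 Q2)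
    (lam : ℕ) : 0 ≤ (D : ℤ) * lev2 (EK ∪ E₁ ∪ E₂) b s t T lam :=
  ring_level_nonneg_of_symCert hdK1 hdK2 hd12 hK h₁ h₂ hK1 h12 hK2 hu2 hv1 huv huw hvw hb1 hb2 hsK hs2 htK ht1 hbu hbv hsu hsv hsw htu htv htw hbs hbt hst T D Finset.univ (fun j => (prods.map Prod3G.toProd3).get j) hcert
    (Prod3G.valid3 hKsp h1sp h2sp hbK hs1 ht2 hbv hbu hsu hsw htw htv prods hok) lam

end GenDict

end FK

end Summit.CriticalPhenomena.PercolationContinuityZ3.Theorems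

end
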